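import Mathlib.Analysis.InnerProductSpace.PiL2
import Mathlib.MeasureTheory.Measure.Haar.InnerProductSpace
import Mathlib.MeasureTheory.Measure.Lebesgue.EqHaar
import HarnessLib

/-!
# Solid and dihedral angles as unit-ball volume fractions

Normalised solid angles and dihedral angles of cones and wedges in `ℝ³`, defined WITHOUT
trigonometry as the fraction of the volume of the unit ball at the apex lying inside the cone /
wedge — the form inlined in the items of route
`Summits/AtomisticToContinuum/…/Theses/ReggeStarBounds.lean` (`SolidAngleFlatness`,
`DihedralFlatness`, `SliverCellsUnbounded`):

* `apexCone v u = {v + ∑ᵢ cᵢ uᵢ : cᵢ ≥ 0}` — the closed convex cone with apex `v` spanned by a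
  finite family of vectors `u`; `apexWedge v d u = {v + s d + ∑ᵢ cᵢ uᵢ : s ∈ ℝ, cᵢ ≥ 0}` — the
  wedge along the line `v + ℝd`;
* `ballFraction v S = vol(B(v,1) ∩ S) / vol(B(v,1))` (real quotient of `volume`s; `0` if the unit
  ball has volume `0` or `∞`);
* `solidAngleFraction v u := ballFraction v (apexCone v u)` for `u : Fin 3 → ℝ³` — the solid angle
  at `v` of the cone, divided by `4π` (Hales 2012, §3.2: the solid angle of a measurable cone `C`
  at `v` is `3·vol(C ∩ B(v,1))`, so `sol/4π = vol(C ∩ B(v,1))/vol B(v,1)`; Rogers 1958 and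
  Coxeter 1958 use these fractions as the weights of the partition of unity around a vertex);
* `dihedralFraction v w u := ballFraction v (apexWedge v (w − v) u)` for `u : Fin 2 → ℝ³` — the
  dihedral angle along the edge `vw` of the wedge `ℝ(w − v) + cone(u₀, u₁)`, divided by `2π`
  (Hales 2012, Def. 2.66 `dih`, and Lemma 3.23 / §8.6.2 relating `sol = dih₁ + dih₂ + dih₃ − π`,
  Girard's formula).

With `u i = p k i − v` the unfolding lemmas `solidAngleFraction_eq` / `dihedralFraction_eq` give
literally the summands of the route items (`rfl`).

API proved: membership/unfolding lemmas, the apex lies in its cone/wedge, dilation invariance of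
cones about the apex (`add_smul_sub_mem_apexCone`), and `0 ≤ fraction ≤ 1`.
Not here (wanted later, genuine theorems): additivity/flatness over a triangulated neighbourhood
(the route items themselves), Girard's formula linking `solidAngleFraction` to the three
`dihedralFraction`s and `dihedralFraction = arccos(dihCos)/2π`
(`Literature.Barriers.AtomisticToContinuum.dihCos`, Hales Def. 2.66), the values on the regular
tetrahedron / octahedron (`regTetSolidAngle`, `tetDihedralAngle`, `octDihedralAngle_eq` in
`Literature/Barriers/AtomisticToContinuum/`), rotation invariance.
-/

noncomputable section

open MeasureTheory Metric
open scoped BigOperators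

namespace Literature.Geometry.DiscreteGeometry

/-! ### Cones and wedges with a given apex -/

section Cones

variable {V : Type*} [AddCommGroup V] [Module ℝ V] {ι : Type*} [Fintype ι]

/-- The closed convex cone with apex `v` spanned by the vectors `u i`:
`{v + ∑ᵢ cᵢ • uᵢ : cᵢ ≥ 0}`. [cite: HalesDSP2012, §3.2 (cones C(v, ·) at an apex)] -/
def apexCone (v : V) (u : ι → V) : Set V :=
  {q | ∃ c : ι → ℝ, (∀ i, 0 ≤ c i) ∧ q = v + ∑ i, c i • u i}

/-- The wedge with edge line `v + ℝ d` spanned by the vectors `u i`: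
`{v + s • d + ∑ᵢ cᵢ • uᵢ : s ∈ ℝ, cᵢ ≥ 0}`. [cite: HalesDSP2012, Definition 2.66 (dihedral angle along {v₀, v₁})] -/
def apexWedge (v d : V) (u : ι → V) : Set V :=
  {q | ∃ s : ℝ, ∃ c : ι → ℝ, (∀ i, 0 ≤ c i) ∧ q = v + s • d + ∑ i, c i • u i}

/-- Membership in `apexCone`, unfolded. [folklore] -/
theorem mem_apexCone_iff (v : V) (u : ι → V) (q : V) :
    q ∈ apexCone v u ↔ ∃ c : ι → ℝ, (∀ i, 0 ≤ c i) ∧ q = v + ∑ i, c i • u i :=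
  Iff.rfl

/-- Membership in `apexWedge`, unfolded. [folklore] -/
theorem mem_apexWedge_iff (v d : V) (u : ι → V) (q : V) :
    q ∈ apexWedge v d u ↔ ∃ s : ℝ, ∃ c : ι → ℝ, (∀ i, 0 ≤ c i) ∧ q = v + s • d + ∑ i, c i • u i :=
  Iff.rfl

/-- The apex lies in its cone. [folklore] -/
theorem self_mem_apexCone (v : V) (u : ι → V) : v ∈ apexCone v u :=
  ⟨0, fun _ => le_rfl, by simp⟩

/-- The apex lies in its wedge. [folklore] -/
theorem self_mem_apexWedge (v d : V) (u : ι → V) : v ∈ apexWedge v d u :=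
  ⟨0, 0, fun _ => le_rfl, by simp⟩

/-- The generators lie in the cone: `v + u i ∈ apexCone v u`. [folklore] -/
theorem add_mem_apexCone [DecidableEq ι] (v : V) (u : ι → V) (i : ι) : v + u i ∈ apexCone v u := by
  refine ⟨Pi.single i 1, fun j => ?_, ?_⟩
  · rcases eq_or_ne j i with rfl | h
    · simp
    · simp [h]
  · simp [Pi.single_apply, Finset.sum_ite_eq']

/-- The cone is a subset of the wedge along any direction (take `s = 0`). [folklore] -/
theorem apexCone_subset_apexWedge (v d : V) (u : ι → V) : apexCone v u ⊆ apexWedge v d u := by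
  rintro q ⟨c, hc, rfl⟩
  exact ⟨0, c, hc, by simp⟩

/-- **Dilation invariance about the apex**: if `q ∈ apexCone v u` and `t ≥ 0` then
`v + t • (q − v) ∈ apexCone v u`. [folklore] -/
theorem add_smul_sub_mem_apexCone {v : V} {u : ι → V} {q : V} (hq : q ∈ apexCone v u) {t : ℝ}
    (ht : 0 ≤ t) : v + t • (q - v) ∈ apexCone v u := by
  obtain ⟨c, hc, rfl⟩ := hq
  refine ⟨fun i => t * c i, fun i => mul_nonneg ht (hc i), ?_⟩
  simp [Finset.smul_sum, smul_smul]

/-- Dilation invariance of the wedge about the apex (all real `t`: the edge direction absorbs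
the sign only for `s`, so `t ≥ 0` is still needed for the cone part). [folklore] -/
theorem add_smul_sub_mem_apexWedge {v d : V} {u : ι → V} {q : V} (hq : q ∈ apexWedge v d u)
    {t : ℝ} (ht : 0 ≤ t) : v + t • (q - v) ∈ apexWedge v d u := by
  obtain ⟨s, c, hc, rfl⟩ := hq
  refine ⟨t * s, fun i => t * c i, fun i => mul_nonneg ht (hc i), ?_⟩
  simp [Finset.smul_sum, smul_smul, smul_add, add_assoc]

end Cones

/-! ### Unit-ball volume fractions -/

section Fraction

variable {X : Type*} [PseudoMetricSpace X] [MeasureSpace X]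

/-- The fraction of the volume of the unit ball at `v` lying in `S`:
`vol(B(v,1) ∩ S) / vol(B(v,1))` as a real number (`0` when the unit ball has volume `0` or `∞`).
[cite: HalesDSP2012, §3.2 (sol(C) = 3·vol(C ∩ B(v,1)))] -/
def ballFraction (v : X) (S : Set X) : ℝ :=
  (volume (ball v 1 ∩ S)).toReal / (volume (ball v (1 : ℝ))).toReal

/-- Unfolding lemma for `ballFraction`. [folklore] -/
theorem ballFraction_eq (v : X) (S : Set X) :
    ballFraction v S = (volume (ball v 1 ∩ S)).toReal / (volume (ball v (1 : ℝ))).toReal :=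
  rfl

/-- A volume fraction is nonnegative. [folklore] -/
theorem ballFraction_nonneg (v : X) (S : Set X) : 0 ≤ ballFraction v S :=
  div_nonneg ENNReal.toReal_nonneg ENNReal.toReal_nonneg

/-- A volume fraction is at most `1`. [folklore] -/
theorem ballFraction_le_one (v : X) (S : Set X) : ballFraction v S ≤ 1 := by
  unfold ballFraction
  rcases eq_or_ne (volume (ball v (1 : ℝ))).toReal 0 with h0 | h0
  · rw [h0, div_zero]
    exact zero_le_one
  · rw [div_le_one (lt_of_le_of_ne ENNReal.toReal_nonneg (Ne.symm h0))]
    have htop : volume (ball v (1 : ℝ)) ≠ ⊤ := fun h => h0 (by simp [h])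
    exact ENNReal.toReal_mono htop (measure_mono Set.inter_subset_left)

/-- The fraction of the whole space (or of any set containing the unit ball) is `1` when the unit
ball has positive finite volume. [folklore] -/
theorem ballFraction_eq_one_of_subset (v : X) {S : Set X} (hS : ball v 1 ⊆ S)
    (h0 : volume (ball v (1 : ℝ)) ≠ 0) (htop : volume (ball v (1 : ℝ)) ≠ ⊤) :
    ballFraction v S = 1 := by
  rw [ballFraction, Set.inter_eq_self_of_subset_left hS,
    div_self (ENNReal.toReal_ne_zero.2 ⟨h0, htop⟩)]

end Fraction

/-! ### Solid angles and dihedral angles in `ℝ³` -/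

/-- **Normalised solid angle** of the cone with apex `v ∈ ℝ³` spanned by `u₀, u₁, u₂`: the fraction
of the volume of the unit ball at `v` inside `apexCone v u`, i.e. `sol/4π` (Hales 2012, §3.2;
Rogers 1958; Coxeter 1958). [cite: HalesDSP2012, §3.2] -/
def solidAngleFraction (v : EuclideanSpace ℝ (Fin 3)) (u : Fin 3 → EuclideanSpace ℝ (Fin 3)) : ℝ :=
  ballFraction v (apexCone v u)

/-- **Normalised dihedral angle** along the edge from `v` to `w` of the wedge
`ℝ(w − v) + cone(u₀, u₁)`: the fraction of the volume of the unit ball at `v` inside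
`apexWedge v (w − v) u`, i.e. `dih/2π` (Hales 2012, Def. 2.66; Coxeter 1958).
[cite: HalesDSP2012, Definition 2.66] -/
def dihedralFraction (v w : EuclideanSpace ℝ (Fin 3)) (u : Fin 2 → EuclideanSpace ℝ (Fin 3)) : ℝ :=
  ballFraction v (apexWedge v (w - v) u)

/-- Unfolding lemma: `solidAngleFraction` in the literal form used by the route items
(with `u i = p k i − v`). [folklore] -/
theorem solidAngleFraction_eq (v : EuclideanSpace ℝ (Fin 3)) (u : Fin 3 → EuclideanSpace ℝ (Fin 3)) :
    solidAngleFraction v u =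
      (volume (Metric.ball v 1 ∩ {q | ∃ c : Fin 3 → ℝ, (∀ i, 0 ≤ c i) ∧ q = v + ∑ i, c i • u i})).toReal /
        (volume (Metric.ball v (1 : ℝ))).toReal :=
  rfl

/-- Unfolding lemma: `dihedralFraction` in the literal form used by the route items
(with `u i = p k i − v`). [folklore] -/
theorem dihedralFraction_eq (v w : EuclideanSpace ℝ (Fin 3)) (u : Fin 2 → EuclideanSpace ℝ (Fin 3)) :
    dihedralFraction v w u =
      (volume (Metric.ball v 1 ∩ {q | ∃ s : ℝ, ∃ c : Fin 2 → ℝ, (∀ i, 0 ≤ c i) ∧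
          q = v + s • (w - v) + ∑ i, c i • u i})).toReal /
        (volume (Metric.ball v (1 : ℝ))).toReal :=
  rfl

/-- `0 ≤ solidAngleFraction ≤ 1`. [folklore] -/
theorem solidAngleFraction_mem_Icc (v : EuclideanSpace ℝ (Fin 3))
    (u : Fin 3 → EuclideanSpace ℝ (Fin 3)) : solidAngleFraction v u ∈ Set.Icc (0 : ℝ) 1 :=
  ⟨ballFraction_nonneg _ _, ballFraction_le_one _ _⟩

/-- `0 ≤ dihedralFraction ≤ 1`. [folklore] -/
theorem dihedralFraction_mem_Icc (v w : EuclideanSpace ℝ (Fin 3))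
    (u : Fin 2 → EuclideanSpace ℝ (Fin 3)) : dihedralFraction v w u ∈ Set.Icc (0 : ℝ) 1 :=
  ⟨ballFraction_nonneg _ _, ballFraction_le_one _ _⟩

/-- Monotonicity: for a common family of generators the cone lies in the wedge
(`apexCone_subset_apexWedge`), so its volume fraction is not larger. [folklore] -/
theorem ballFraction_apexCone_le_apexWedge (v d : EuclideanSpace ℝ (Fin 3))
    (u : Fin 2 → EuclideanSpace ℝ (Fin 3)) :
    ballFraction v (apexCone v u) ≤ ballFraction v (apexWedge v d u) := by
  unfold ballFraction
  rcases eq_or_ne (volume (ball v (1 : ℝ))).toReal 0 with h0 | h0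
  · simp [h0]
  · have hpos : 0 < (volume (ball v (1 : ℝ))).toReal :=
      lt_of_le_of_ne ENNReal.toReal_nonneg (Ne.symm h0)
    rw [div_le_div_iff_of_pos_right hpos]
    have htop : volume (ball v (1 : ℝ)) ≠ ⊤ := fun h => h0 (by simp [h])
    refine ENNReal.toReal_mono (ne_top_of_le_ne_top htop (measure_mono Set.inter_subset_left)) ?_
    exact measure_mono (Set.inter_subset_inter_right _ (apexCone_subset_apexWedge v d u))

end Literature.Geometry.DiscreteGeometry

end
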